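import Summits.HodgeConjecture.HodgeConjecture.Theses.MomentAmplification
import Literature.AlgebraicGeometry.Motives.CorrespondencesAlgebraicOperators
import Literature.AlgebraicGeometry.Motives.CorrespondencesTraceFormula
import Literature.AlgebraicGeometry.Motives.CharpolyOfRationalTraces

/-!
# Birth skeleton (BC3) for crux `LefschetzBetti` — route `MomentAmplification`

Crux (item stmt-HodgeConjecture-11036, FIXED, not restated):
`Summit.HodgeConjecture.HodgeConjecture.Theses.MomentAmplification.LefschetzBetti` =
Grothendieck's standard conjecture of Lefschetz type `B(X)/ℂ` in `θ`-form for the Weil cohomology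
`B.W` of every comparison-compatible Betti–Hodge realization `B` (definitionally
`∀ B, B.IsComparisonCompatible → B.W.LefschetzStandardConjecture`).

LINE (Kleiman–Lieberman factorisation; Kleiman 1968 §2; Kleiman 1994 §4, Thm. 4-1; Lieberman 1968;
Murre's Torino lectures 1994 §7: `B` holds for abelian varieties (Kleiman, Lieberman) by this route):

  `B(X, η)` ⟸ `HL(B.W)` ∧ `C(X)` ∧ `QI(X)`,

* `stub_hardLefschetz` — hard Lefschetz for `B.W` of every comparison-compatible `B` (a KNOWN
  theorem: classical hard Lefschetz `HodgeTheory.nonempty_hardLefschetzNFold_holds` transported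
  along the comparison `toComplexBetti`; M/L-sized transport, not yet in the tree for
  `BettiHodgeData`);
* `stub_kunnethProjector` — `C(X)/ℂ`: every Künneth projector `πⁱ = [id_{Hⁱ}]` of `B.W` is induced
  by an algebraic correspondence (one-component form, `standardConjectureC_iff`); OPEN in general
  over `ℂ` (known: curves, surfaces, abelian varieties; `B ⇒ C`);
* `stub_algebraicIso` — the `η`-FREE core: for `i + r = n` SOME algebraic correspondence induces
  SOME linear isomorphism `H²ⁿ⁻ⁱ(X) ⥲ Hⁱ(X)` (no relation to `L` required: Pontryagin/Fourier
  products, Lefschetz pencils of another polarisation, Chern classes of Fourier–Mukai kernels are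
  admissible sources); OPEN, the load-bearing stub.

GLUE (REAL proofs, no sorry; pattern of the tree theorem
`WeilCohomology.standardConjectureB_of_standardConjectureB`, CorrespondencesHyperplaneProofs):
`standardConjectureB_of_algebraicIso` — for ANY Weil cohomology `W` (char. 0 coefficients), smooth
projective `X`, hyperplane class `η` with hard Lefschetz, algebraic `πⁱ` and `η`-free algebraic
isomorphisms `u : Hʲ ⥲ Hⁱ`: `w := u ∘ Lʳ_η` is an algebraic (`IsAlgebraicOperator.comp_lefschetzPow`)
automorphism of `Hⁱ(X)`; its powers are algebraic (`IsAlgebraicOperator.pow`, needs `πⁱ`), so their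
traces are rational (Lefschetz trace formula `exists_rat_trace_of_isAlgebraicOperator`);
Cayley–Hamilton (`LinearMap.exists_inverse_eq_sum_ratCast_smul_pow`) writes `w⁻¹ = ∑ qₘ wᵐ`,
algebraic (`IsAlgebraicOperator.sum_ratCast_smul`); `θ := w⁻¹ ∘ u` is algebraic
(`IsAlgebraicOperator.comp`) and a two-sided inverse of `Lʳ_η`, i.e. `B(X, η)` in `θ`-form.
`LefschetzBetti_of : LefschetzBetti` — the crux BY NAME from the three declared stubs through that
glue (A12 skeleton shape: no hypotheses, `sorry` only inside `stub_*`).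

Disproof used: none relevant (no `Disproof.lean` / Negative lemmas exist for this crux at
registration time, `ledger crux ls stmt-HodgeConjecture-11036`: no workfiles).
-/

-- `Summit.<Summit>.<Problem>`: for the single-conjunct summit the duplicate `HodgeConjecture.HodgeConjecture` is mandated.
set_option linter.dupNamespace false

noncomputable section

namespace Summit.HodgeConjecture.HodgeConjecture.Cruxes.LefschetzBetti.Birth

open Literature.AlgebraicGeometry.Motives

universe u v

/-! ## Glue (sorry-free): Lieberman's Cayley–Hamilton lemma for an arbitrary Weil cohomology -/

/-- **`B(X, η)` from hard Lefschetz, algebraic Künneth projectors and `η`-free algebraic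
isomorphisms** (Kleiman 1968 §2; Kleiman 1994 §4, Thm. 4-1; Lieberman 1968): for a Weil
cohomology `W` with coefficients of characteristic `0`, `X` smooth projective of dimension `n` and a
hyperplane class `η` such that every `Lʳ_η : Hⁱ → H²ⁿ⁻ⁱ` (`i + r = n`) is bijective, every
`id_{Hⁱ(X)}` is induced by an algebraic correspondence, and for every `i + r = n` some algebraic
correspondence induces a linear isomorphism `H²ⁿ⁻ⁱ(X) ⥲ Hⁱ(X)`, the standard conjecture `B(X, η)`
holds in `θ`-form: `θ := w⁻¹ ∘ u` with `w := u ∘ Lʳ_η`, `w⁻¹ ∈ ℚ[w]` by Cayley–Hamilton and the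
rationality of the traces of the algebraic operators `wᵐ`. [cite: Kleiman1968, §2] -/
theorem standardConjectureB_of_algebraicIso {k : Type u} [Field k] {K : Type v} [Field K]
    [CharZero K] (W : WeilCohomology k K) {n : ℕ} {X : SchemeOver k}
    (hX : IsSmoothProjective n X) {η : W.obj X 2} (hη : W.IsHyperplaneClass X η)
    (hL : ∀ (i r j : ℕ), i + r = n → ∀ h : i + 2 * r = j,
      Function.Bijective (W.lefschetzPow X η r i j h))
    (hC : ∀ i : ℕ, W.IsAlgebraicOperator n n (LinearMap.id : W.obj X i →ₗ[K] W.obj X i))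
    (hQI : ∀ (i r j : ℕ), i + r = n → i + 2 * r = j →
      ∃ u : W.obj X j →ₗ[K] W.obj X i, Function.Bijective u ∧ W.IsAlgebraicOperator n n u) :
    W.StandardConjectureB n X η := by
  intro i r j h₁ h₂
  -- the three inputs in bidegree `(j, i)`
  obtain ⟨u, hubij, hualg⟩ := hQI i r j h₁ h₂
  have hid : W.IsAlgebraicOperator n n (LinearMap.id : W.obj X i →ₗ[K] W.obj X i) := hC i
  have hbij : Function.Bijective (W.lefschetzPow X η r i j h₂) := hL i r j h₁ h₂
  -- `w = u ∘ Lʳ_η` is an algebraic automorphism of `Hⁱ(X)`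
  set w : W.obj X i →ₗ[K] W.obj X i := u ∘ₗ W.lefschetzPow X η r i j h₂ with hw
  have walg : W.IsAlgebraicOperator n n w := hualg.comp_lefschetzPow hX hX hη h₂
  have hunit : IsUnit w := (Module.End.isUnit_iff w).mpr (hubij.comp hbij)
  -- the powers of `w` are algebraic (uses `πⁱ` algebraic), hence have rational traces
  haveI := W.finite_obj hX i
  have htr : ∀ m : ℕ, ∃ q : ℚ, LinearMap.trace K _ (w ^ (m + 1)) = q := fun m ↦
    W.exists_rat_trace_of_isAlgebraicOperator hX (walg.pow hX hid (m + 1))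
  -- Cayley–Hamilton: `w⁻¹ = ∑ qₘ wᵐ`, `qₘ ∈ ℚ`, is algebraic
  obtain ⟨q, hv, -⟩ := LinearMap.exists_inverse_eq_sum_ratCast_smul_pow w hunit htr
  set v : W.obj X i →ₗ[K] W.obj X i :=
    ∑ m ∈ Finset.range (Module.finrank K (W.obj X i)), ((q m : ℚ) : K) • w ^ m with hv'
  have valg : W.IsAlgebraicOperator n n v :=
    PreWeilCohomology.IsAlgebraicOperator.sum_ratCast_smul _ q fun m _ ↦ walg.pow hX hid m
  -- `θ = w⁻¹ ∘ u` is the algebraic two-sided inverse of `Lʳ_η`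
  have hleft : (v ∘ₗ u) ∘ₗ W.lefschetzPow X η r i j h₂ = LinearMap.id := by
    rw [LinearMap.comp_assoc, ← hw, ← Module.End.mul_eq_comp, hv, Module.End.one_eq_id]
  refine ⟨v ∘ₗ u, ⟨h₁, hleft, ?_⟩, valg.comp hX hX hX hualg⟩
  refine LinearMap.ext fun y ↦ ?_
  obtain ⟨x, rfl⟩ := hbij.2 y
  have hx := LinearMap.congr_fun hleft x
  simp only [LinearMap.comp_apply, LinearMap.id_apply] at hx ⊢
  rw [hx]

/-! ## The three registered stubs (`sorry` lives ONLY here) -/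

/-- **stub 1 — hard Lefschetz for compatible Betti–Hodge realizations** (KNOWN theorem; Voisin,
*Hodge Theory I*, Thm. 6.25; in-tree for singular cohomology as
`HodgeTheory.nonempty_hardLefschetzNFold_holds`, to be transported along the comparison
isomorphism using `iso_cup` and the algebraicity of `B.W`-hyperplane classes): for every
comparison-compatible `B`, every smooth projective `X` of dimension `n`, every hyperplane class
`η` of `B.W` and `i + r = n`, `Lʳ : Hⁱ(X) → Hⁱ⁺²ʳ(X)` is bijective. Size M/L (transport). -/
theorem stub_hardLefschetz :
    ∀ B : BettiHodgeData ℂ, B.IsComparisonCompatible → B.W.HasHardLefschetz := by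
  sorry

/-- **stub 2 — `C(X)/ℂ`, algebraic Künneth projectors** (Grothendieck's standard conjecture of
Künneth type for `B.W`, one-component form `standardConjectureC_iff`; Kleiman 1968 §2 `C(X)`;
OPEN in general over `ℂ`, known for curves, surfaces, abelian varieties and implied by `B(X)`):
for every comparison-compatible `B`, every smooth projective `X` of dimension `n` and every `i`,
`id : Hⁱ(X) → Hⁱ(X)` (the projector `πⁱ` as a one-component graded operator) is induced by an
algebraic correspondence with `ℚ`-coefficients. Size: open problem (strictly below `B`). -/
theorem stub_kunnethProjector :
    ∀ B : BettiHodgeData ℂ, B.IsComparisonCompatible →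
      ∀ ⦃n : ℕ⦄ ⦃X : SchemeOver ℂ⦄, IsSmoothProjective n X →
        ∀ i : ℕ, B.W.IsAlgebraicOperator n n (LinearMap.id : B.W.obj X i →ₗ[ℚ] B.W.obj X i) := by
  sorry

/-- **stub 3 — `η`-free algebraic isomorphisms `H²ⁿ⁻ⁱ ⥲ Hⁱ`** (Kleiman 1968 §2 /
Kleiman 1994 §4: the form of `B(X)` Lieberman verified for abelian varieties; OPEN in
general, the load-bearing stub): for every comparison-compatible `B`, every smooth projective `X`
of dimension `n` and `i + r = n`, `i + 2r = j`, SOME linear isomorphism `u : Hʲ(X) ⥲ Hⁱ(X)` is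
induced by an algebraic correspondence with `ℚ`-coefficients (no compatibility with the
Lefschetz operator of any hyperplane class is asked). Size: open problem (crux-hard core). -/
theorem stub_algebraicIso :
    ∀ B : BettiHodgeData ℂ, B.IsComparisonCompatible →
      ∀ ⦃n : ℕ⦄ ⦃X : SchemeOver ℂ⦄, IsSmoothProjective n X →
        ∀ (i r j : ℕ), i + r = n → i + 2 * r = j →
          ∃ u : B.W.obj X j →ₗ[ℚ] B.W.obj X i,
            Function.Bijective u ∧ B.W.IsAlgebraicOperator n n u := by
  sorry

/-! ## The skeleton theorem: the crux BY NAME from the declared stubs -/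

/-- **THE SKELETON THEOREM.** The crux
`Summit.HodgeConjecture.HodgeConjecture.Theses.MomentAmplification.LefschetzBetti` (Grothendieck's
`B(X)/ℂ` in `θ`-form for every compatible `B.W`), concluded BY NAME from the three declared stubs
through the sorry-free glue `standardConjectureB_of_algebraicIso` (Lieberman's Cayley–Hamilton
argument, Kleiman 1968 §2). [cite: Kleiman1968, §2] -/
theorem LefschetzBetti_of :
    Summit.HodgeConjecture.HodgeConjecture.Theses.MomentAmplification.LefschetzBetti := by
  intro B hc n X hX η hη
  exact standardConjectureB_of_algebraicIso B.W hX hη (stub_hardLefschetz B hc hX η hη)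
    (stub_kunnethProjector B hc hX) (stub_algebraicIso B hc hX)

/-! ## Sanity (sorry-free): each stub is implied by the crux, so none is refutable short of `¬B` -/

/-- The crux implies stub 1 (the `θ`-form of `B(X)` contains hard Lefschetz). [folklore] -/
theorem hardLefschetz_of_crux
    (h : Summit.HodgeConjecture.HodgeConjecture.Theses.MomentAmplification.LefschetzBetti) :
    ∀ B : BettiHodgeData ℂ, B.IsComparisonCompatible → B.W.HasHardLefschetz :=
  fun B hc _n _X hX η hη _i _r _j h₁ h₂ ↦
    WeilCohomology.StandardConjectureB.bijective_lefschetzPow (h B hc hX η hη) h₁ h₂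

/-- The crux implies stub 3 (`θ` itself is an algebraic isomorphism), GIVEN a hyperplane class on
`X` (every smooth projective `X` carries one; kept as a hypothesis to stay import-light). [folklore] -/
theorem algebraicIso_of_crux
    (h : Summit.HodgeConjecture.HodgeConjecture.Theses.MomentAmplification.LefschetzBetti)
    (B : BettiHodgeData ℂ) (hc : B.IsComparisonCompatible) {n : ℕ} {X : SchemeOver ℂ}
    (hX : IsSmoothProjective n X) {η : B.W.obj X 2} (hη : B.W.IsHyperplaneClass X η)
    (i r j : ℕ) (h₁ : i + r = n) (h₂ : i + 2 * r = j) :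
    ∃ u : B.W.obj X j →ₗ[ℚ] B.W.obj X i, Function.Bijective u ∧ B.W.IsAlgebraicOperator n n u := by
  obtain ⟨θ, ⟨_, hθ₁, hθ₂⟩, halg⟩ := h B hc hX η hη i r j h₁ h₂
  refine ⟨θ, Function.bijective_iff_has_inverse.mpr ⟨B.W.lefschetzPow X η r i j h₂,
    fun y ↦ LinearMap.congr_fun hθ₂ y, fun x ↦ LinearMap.congr_fun hθ₁ x⟩, halg⟩

/-- The crux implies stub 2 (`πⁱ = θ ∘ Lⁿ⁻ⁱ` for `i ≤ n`; for `i > 2n` the group vanishes; the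
degrees `n < i ≤ 2n` need the transpose `ᵗπ²ⁿ⁻ⁱ`, not reproved here), in degrees `i ≤ n` and GIVEN a
hyperplane class. [folklore] -/
theorem kunnethProjector_low_of_crux
    (h : Summit.HodgeConjecture.HodgeConjecture.Theses.MomentAmplification.LefschetzBetti)
    (B : BettiHodgeData ℂ) (hc : B.IsComparisonCompatible) {n : ℕ} {X : SchemeOver ℂ}
    (hX : IsSmoothProjective n X) {η : B.W.obj X 2} (hη : B.W.IsHyperplaneClass X η)
    {i : ℕ} (hi : i ≤ n) :
    B.W.IsAlgebraicOperator n n (LinearMap.id : B.W.obj X i →ₗ[ℚ] B.W.obj X i) := by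
  obtain ⟨θ, hθ, halg⟩ := h B hc hX η hη i (n - i) (i + 2 * (n - i)) (by omega) rfl
  exact B.W.isAlgebraicOperator_id_of_isLefschetzTheta hX hη hθ halg

end Summit.HodgeConjecture.HodgeConjecture.Cruxes.LefschetzBetti.Birth

end
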